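import Summits.BirchSwinnertonDyer.BirchSwinnertonDyer.Theorems.ManinLocalTwoThreeCubeTransfer
import HarnessLib

/-!
# The cube step, II: the compatible pair at a level prime to 3 and the conjugation invariance of its restriction
# (route `ManinLocalTwoThree`, cell bsd-f2-manin; crux C3 `ManinPrimeToThreeAtNine` stmt-BirchSwinnertonDyer-22968; prover seat p3
# gen 10; toolkit for es's cube-step nodes E-es-103 `CubeStepDescent` / E-es-104 `CubeStepAntiDescent`, MEMO-es §37.9 (3)–(4))

Level `M` with `3 ∤ M`, `G = Γ₀(M)` acting on `P¹(𝔽₃)` (`…CubeTransfer.lean`):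
* §1 the subgroups `stabInf M = Γ₀(3M) = Stab(∞)`, `stabZero M = Γ₀(M) ∩ Γ⁰(3) = Stab(0)` and the kernel `kerAct M`
  (`b ≡ c ≡ 0 (mod 3)`, normal), with their entrywise descriptions; the element `δ` with `3δ + M² = 1`;
* §2 for `φ : Γ₀(3M) → 𝔽₃` additive with `φ(a, 3b; c, d) = ε·φ(a, b; 3c, d)` (`ε = ±1`: (anti-)invariance under the
  3-shift): the coshift character `coshift φ ε = ε·φ(a, b/3; 3c, d)` is additive on `stabZero`, the restriction
  `restr φ = φ(a, b; c, d)` is additive on `stabInf`, and they AGREE on `kerAct` (`coshift_eq_restr`);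
* §3 `Γ₀(M) = T^v · stabZero · T^{-u}` pointwise (`exists_conj_mem_stabZero`), hence the common restriction `ρ = restr φ`
  to `kerAct` is invariant under conjugation by all of `Γ₀(M)` (`restr_conj`); and `stabInf = kerAct · ⟨T⟩`
  (`exists_kerAct_mul_Tpow`).
Nothing about BSD, Manin's conjecture or the laws E-es-94♯/96–107 is asserted here.
-/

set_option autoImplicit false
set_option linter.dupNamespace false

open scoped MatrixGroups

open CongruenceSubgroup Matrix.SpecialLinearGroup
  Summit.BirchSwinnertonDyer.Rank1Residual.ManinAdditive.NineShiftEqualiser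

namespace Summit.BirchSwinnertonDyer.BirchSwinnertonDyer.Theorems.ManinLocalTwoThree

namespace CubeStep

open ThreeShiftDescent

/-! ### §1. The three subgroups of `Γ₀(M)` and their entries -/

section Subgroups

variable (M : ℕ)

/-- `Stab(∞) = {γ ∈ Γ₀(M) : 3 ∣ c} = Γ₀(3M)` (for `3 ∤ M`). [folklore] -/
def stabInf : Subgroup (Gamma0 M) where
  carrier := {γ | act (γ : SL(2, ℤ)) none = none}
  mul_mem' := by
    intro x y hx hy
    simp only [Set.mem_setOf_eq, Subgroup.coe_mul, act_mul] at *
    rw [hy, hx]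
  one_mem' := by simp [act_one]
  inv_mem' := by
    intro x hx
    simp only [Set.mem_setOf_eq, Subgroup.coe_inv] at *
    conv_lhs => rw [← hx]
    rw [act_inv_act]

/-- `Stab(0) = {γ ∈ Γ₀(M) : 3 ∣ b} = Γ₀(M) ∩ Γ⁰(3)`. [folklore] -/
def stabZero : Subgroup (Gamma0 M) where
  carrier := {γ | act (γ : SL(2, ℤ)) (some 0) = some 0}
  mul_mem' := by
    intro x y hx hy
    simp only [Set.mem_setOf_eq, Subgroup.coe_mul, act_mul] at *
    rw [hy, hx]
  one_mem' := by simp [act_one]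
  inv_mem' := by
    intro x hx
    simp only [Set.mem_setOf_eq, Subgroup.coe_inv] at *
    conv_lhs => rw [← hx]
    rw [act_inv_act]

/-- The kernel of the action on `P¹(𝔽₃)`: `{γ ∈ Γ₀(M) : γ ≡ ±I (mod 3)}`. [folklore] -/
def kerAct : Subgroup (Gamma0 M) where
  carrier := {γ | ∀ ℓ, act (γ : SL(2, ℤ)) ℓ = ℓ}
  mul_mem' := by
    intro x y hx hy ℓ
    simp only [Set.mem_setOf_eq] at hx hy
    rw [Subgroup.coe_mul, act_mul, hy, hx]
  one_mem' := fun ℓ => by simp [act_one]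
  inv_mem' := by
    intro x hx ℓ
    simp only [Set.mem_setOf_eq] at hx
    conv_lhs => rw [← hx ℓ]
    rw [Subgroup.coe_inv, act_inv_act]

variable {M}

/-- Membership in `stabInf`. [folklore] -/
theorem mem_stabInf {γ : Gamma0 M} : γ ∈ stabInf M ↔ act (γ : SL(2, ℤ)) none = none := Iff.rfl

/-- Membership in `stabZero`. [folklore] -/
theorem mem_stabZero {γ : Gamma0 M} : γ ∈ stabZero M ↔ act (γ : SL(2, ℤ)) (some 0) = some 0 := Iff.rfl

/-- Membership in `kerAct`. [folklore] -/
theorem mem_kerAct {γ : Gamma0 M} : γ ∈ kerAct M ↔ ∀ ℓ, act (γ : SL(2, ℤ)) ℓ = ℓ := Iff.rfl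

/-- `kerAct` by entries: `3 ∣ b` and `3 ∣ c`. [folklore] -/
theorem mem_kerAct_iff {γ : Gamma0 M} :
    γ ∈ kerAct M ↔ (3 : ℤ) ∣ ((γ : SL(2, ℤ)) 0 1 : ℤ) ∧ (3 : ℤ) ∣ ((γ : SL(2, ℤ)) 1 0 : ℤ) := by
  constructor
  · intro h
    exact ⟨(act_some_zero_eq_iff _).mp (h (some 0)), (act_none_eq_none_iff _).mp (h none)⟩
  · rintro ⟨hb, hc⟩ ℓ
    exact act_eq_self _ hb hc ℓ

/-- `kerAct ≤ stabInf`. [folklore] -/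
theorem stabInf_of_kerAct {γ : Gamma0 M} (h : γ ∈ kerAct M) : γ ∈ stabInf M := h none

/-- `kerAct ≤ stabZero`. [folklore] -/
theorem stabZero_of_kerAct {γ : Gamma0 M} (h : γ ∈ kerAct M) : γ ∈ stabZero M := h (some 0)

/-- `stabInf ∩ stabZero ≤ kerAct`. [folklore] -/
theorem kerAct_of_stab {γ : Gamma0 M} (h1 : γ ∈ stabInf M) (h2 : γ ∈ stabZero M) : γ ∈ kerAct M :=
  fun ℓ => act_eq_self_of_fix _ h1 h2 ℓ

/-- `kerAct` is normal in `Γ₀(M)`. [folklore] -/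
theorem kerAct_conj_mem (g : Gamma0 M) {x : Gamma0 M} (hx : x ∈ kerAct M) : g * x * g⁻¹ ∈ kerAct M := by
  intro ℓ
  rw [Subgroup.coe_mul, Subgroup.coe_mul, act_mul, act_mul, hx, ← act_mul, Subgroup.coe_inv, mul_inv_cancel,
    act_one]

/-- `kerAct` is normal in `Γ₀(M)` (conjugation the other way). [folklore] -/
theorem kerAct_inv_conj_mem (g : Gamma0 M) {x : Gamma0 M} (hx : x ∈ kerAct M) : g⁻¹ * x * g ∈ kerAct M := by
  simpa using kerAct_conj_mem g⁻¹ hx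

/-- **The Bezout element**: for `3 ∤ M` there is `δ` with `3δ + M² = 1`. [folklore] -/
theorem exists_delta (hM3 : ¬ 3 ∣ M) : ∃ δ : ℤ, 3 * δ + (M : ℤ) * M = 1 := by
  have h : M % 3 = 1 ∨ M % 3 = 2 := by omega
  have hM : (M : ℤ) = 3 * (M / 3 : ℕ) + (M % 3 : ℕ) := by exact_mod_cast (Nat.div_add_mod M 3).symm
  rcases h with h | h
  · exact ⟨-(3 * (M / 3 : ℕ) * (M / 3 : ℕ) + 2 * (M / 3 : ℕ)), by rw [hM, h]; push_cast; ring⟩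
  · exact ⟨-(3 * (M / 3 : ℕ) * (M / 3 : ℕ) + 4 * (M / 3 : ℕ) + 1), by rw [hM, h]; push_cast; ring⟩

/-- `3 ∣ c` and `M ∣ c` give `3M ∣ c` when `3 ∤ M`. [folklore] -/
theorem three_mul_dvd (hM3 : ¬ 3 ∣ M) {c : ℤ} (h3 : (3 : ℤ) ∣ c) (hM : (M : ℤ) ∣ c) : ((3 * M : ℕ) : ℤ) ∣ c := by
  obtain ⟨δ, hδ⟩ := exists_delta hM3
  have hcop : IsCoprime (3 : ℤ) (M : ℤ) := ⟨δ, M, by linear_combination hδ⟩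
  push_cast
  exact hcop.mul_dvd h3 hM

/-- `stabInf` by entries: `3M ∣ c`. [folklore] -/
theorem mem_stabInf_iff (hM3 : ¬ 3 ∣ M) {γ : Gamma0 M} :
    γ ∈ stabInf M ↔ ((3 * M : ℕ) : ℤ) ∣ ((γ : SL(2, ℤ)) 1 0 : ℤ) := by
  rw [mem_stabInf, act_none_eq_none_iff]
  constructor
  · intro h
    exact three_mul_dvd hM3 h ((ZMod.intCast_zmod_eq_zero_iff_dvd _ _).mp (Gamma0_mem.mp γ.2))
  · intro h
    exact (dvd_mul_right (3 : ℤ) (M : ℤ)).trans (by exact_mod_cast h)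

/-- `stabZero` by entries: `3 ∣ b`. [folklore] -/
theorem mem_stabZero_iff {γ : Gamma0 M} : γ ∈ stabZero M ↔ (3 : ℤ) ∣ ((γ : SL(2, ℤ)) 0 1 : ℤ) := by
  rw [mem_stabZero, act_some_zero_eq_iff]

/-- Every element of `Γ₀(M)` is `g0Of` of some entries. [folklore] -/
theorem exists_eq_g0Of (x : Gamma0 M) :
    ∃ (a b c d : ℤ) (h : a * d - b * c = 1) (hc : (M : ℤ) ∣ c), x = g0Of a b c d h hc :=
  ⟨_, _, _, _, gamma0_det_entries x, ((ZMod.intCast_zmod_eq_zero_iff_dvd _ _).mp (Gamma0_mem.mp x.2)),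
    (g0Of_entries x (gamma0_det_entries x) ((ZMod.intCast_zmod_eq_zero_iff_dvd _ _).mp (Gamma0_mem.mp x.2))).symm⟩

/-- An element of `stabZero` is `(a, 3b; c, d)`. [folklore] -/
theorem exists_eq_of_mem_stabZero {x : Gamma0 M} (hx : x ∈ stabZero M) :
    ∃ (a b c d : ℤ) (h : a * d - (3 * b) * c = 1) (hc : (M : ℤ) ∣ c), x = g0Of a (3 * b) c d h hc := by
  obtain ⟨b, hb⟩ := mem_stabZero_iff.mp hx
  have hdet := gamma0_det_entries x
  rw [hb] at hdet
  refine ⟨_, b, _, _, hdet, ((ZMod.intCast_zmod_eq_zero_iff_dvd _ _).mp (Gamma0_mem.mp x.2)), ?_⟩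
  calc x = g0Of ((x : SL(2, ℤ)) 0 0) ((x : SL(2, ℤ)) 0 1) ((x : SL(2, ℤ)) 1 0) ((x : SL(2, ℤ)) 1 1)
        (gamma0_det_entries x) ((ZMod.intCast_zmod_eq_zero_iff_dvd _ _).mp (Gamma0_mem.mp x.2)) :=
      (g0Of_entries x (gamma0_det_entries x) ((ZMod.intCast_zmod_eq_zero_iff_dvd _ _).mp (Gamma0_mem.mp x.2))).symm
    _ = _ := g0Of_congr rfl hb rfl rfl _ _ _ _

/-- An element of `stabInf` is `(a, b; c, d)` with `3M ∣ c`. [folklore] -/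
theorem exists_eq_of_mem_stabInf (hM3 : ¬ 3 ∣ M) {x : Gamma0 M} (hx : x ∈ stabInf M) :
    ∃ (a b c d : ℤ) (h : a * d - b * c = 1) (hc : (M : ℤ) ∣ c),
      ((3 * M : ℕ) : ℤ) ∣ c ∧ x = g0Of a b c d h hc :=
  ⟨_, _, _, _, gamma0_det_entries x, ((ZMod.intCast_zmod_eq_zero_iff_dvd _ _).mp (Gamma0_mem.mp x.2)),
    (mem_stabInf_iff hM3).mp hx,
    (g0Of_entries x (gamma0_det_entries x) ((ZMod.intCast_zmod_eq_zero_iff_dvd _ _).mp (Gamma0_mem.mp x.2))).symm⟩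

/-- `g0Of a (3b) c d ∈ stabZero`. [folklore] -/
theorem g0Of_mem_stabZero (a b c d : ℤ) (h : a * d - (3 * b) * c = 1) (hc : (M : ℤ) ∣ c) :
    (g0Of a (3 * b) c d h hc : Gamma0 M) ∈ stabZero M :=
  mem_stabZero_iff.mpr ⟨b, rfl⟩

/-- `g0Of a b c d ∈ stabInf` when `3M ∣ c`. [folklore] -/
theorem g0Of_mem_stabInf (hM3 : ¬ 3 ∣ M) (a b c d : ℤ) (h : a * d - b * c = 1) (hc : (M : ℤ) ∣ c)
    (hc3 : ((3 * M : ℕ) : ℤ) ∣ c) : (g0Of a b c d h hc : Gamma0 M) ∈ stabInf M :=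
  (mem_stabInf_iff hM3).mpr hc3

/-- `T^k ∈ stabInf`. [folklore] -/
theorem Tpow_mem_stabInf (k : ℤ) : (Tpow M k : Gamma0 M) ∈ stabInf M := act_Tpow_none k

/-- `3M ∣ 3c` from `M ∣ c`. [folklore] -/
theorem dvd_three_mul' {c : ℤ} (hc : (M : ℤ) ∣ c) : ((3 * M : ℕ) : ℤ) ∣ 3 * c := by
  obtain ⟨k, hk⟩ := hc
  exact ⟨k, by rw [hk]; push_cast; ring⟩

end Subgroups

/-! ### §2. The compatible pair `(coshift φ ε, restr φ)` -/

section Pair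

variable {M : ℕ}

/-- **The coshift value** `ε·φ(a, b/3; 3c, d)` of `γ = (a b; c d) ∈ Γ₀(M)` when `3 ∣ b` (junk `0` otherwise).
[folklore] -/
noncomputable def coshift (φ : Gamma0 (3 * M) → ZMod 3) (ε : ZMod 3) (γ : Gamma0 M) : ZMod 3 :=
  if h : (3 : ℤ) ∣ ((γ : SL(2, ℤ)) 0 1 : ℤ) then
    ε * φ (g0Of ((γ : SL(2, ℤ)) 0 0) (((γ : SL(2, ℤ)) 0 1 : ℤ) / 3) (3 * (γ : SL(2, ℤ)) 1 0) ((γ : SL(2, ℤ)) 1 1)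
      (by
        have hq : ((γ : SL(2, ℤ)) 0 1 : ℤ) / 3 * 3 = (γ : SL(2, ℤ)) 0 1 := Int.ediv_mul_cancel h
        linear_combination gamma0_det_entries γ - ((γ : SL(2, ℤ)) 1 0 : ℤ) * hq)
      (dvd_three_mul' ((ZMod.intCast_zmod_eq_zero_iff_dvd _ _).mp (Gamma0_mem.mp γ.2))))
  else 0

/-- `coshift` on an explicit matrix `(a, 3b; c, d)`: `ε·φ(a, b; 3c, d)`. [folklore] -/
theorem coshift_g0Of (φ : Gamma0 (3 * M) → ZMod 3) (ε : ZMod 3) (a b c d : ℤ) (h : a * d - (3 * b) * c = 1)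
    (hc : (M : ℤ) ∣ c) (h' : a * d - b * (3 * c) = 1) (hc' : ((3 * M : ℕ) : ℤ) ∣ 3 * c) :
    coshift φ ε (g0Of a (3 * b) c d h hc) = ε * φ (g0Of a b (3 * c) d h' hc') := by
  unfold coshift
  rw [dif_pos (show (3 : ℤ) ∣ (((g0Of a (3 * b) c d h hc : Gamma0 M) : SL(2, ℤ)) 0 1 : ℤ) from ⟨b, rfl⟩)]
  congr 2
  exact g0Of_congr rfl (by show (3 * b) / 3 = b; exact Int.mul_ediv_cancel_left b (by norm_num)) rfl rfl _ _ _ _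

/-- **The restriction value** `φ(γ)` for `γ ∈ Γ₀(M)` with `3M ∣ c` (junk `0` otherwise). [folklore] -/
noncomputable def restr (φ : Gamma0 (3 * M) → ZMod 3) (γ : Gamma0 M) : ZMod 3 :=
  if h : ((3 * M : ℕ) : ℤ) ∣ ((γ : SL(2, ℤ)) 1 0 : ℤ) then
    φ (g0Of ((γ : SL(2, ℤ)) 0 0) ((γ : SL(2, ℤ)) 0 1) ((γ : SL(2, ℤ)) 1 0) ((γ : SL(2, ℤ)) 1 1) (gamma0_det_entries γ) h)
  else 0

/-- `restr` on an explicit matrix with `3M ∣ c`. [folklore] -/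
theorem restr_g0Of (φ : Gamma0 (3 * M) → ZMod 3) (a b c d : ℤ) (h : a * d - b * c = 1)
    (hc : (M : ℤ) ∣ c) (hc' : ((3 * M : ℕ) : ℤ) ∣ c) :
    restr φ (g0Of a b c d h hc) = φ (g0Of a b c d h hc') := by
  unfold restr
  rw [dif_pos (show ((3 * M : ℕ) : ℤ) ∣ (((g0Of a b c d h hc : Gamma0 M) : SL(2, ℤ)) 1 0 : ℤ) from hc')]
  rfl

variable (φ : Gamma0 (3 * M) → ZMod 3) (ε : ZMod 3)

/-- `coshift φ ε` is additive on `stabZero`, for additive `φ`. [folklore] -/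
theorem coshift_add (hadd : IsAddChar φ) :
    ∀ x ∈ stabZero M, ∀ y ∈ stabZero M, coshift φ ε (x * y) = coshift φ ε x + coshift φ ε y := by
  intro x hx y hy
  obtain ⟨a, b, c, d, h, hc, rfl⟩ := exists_eq_of_mem_stabZero hx
  obtain ⟨a', b', c', d', h', hc', rfl⟩ := exists_eq_of_mem_stabZero hy
  have hcp : (M : ℤ) ∣ c * a' + d * c' := dvd_add (Dvd.dvd.mul_right hc _) (Dvd.dvd.mul_left hc' _)
  have hprod : (g0Of a (3 * b) c d h hc * g0Of a' (3 * b') c' d' h' hc' : Gamma0 M) =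
      g0Of (a * a' + (3 * b) * c') (3 * (a * b' + b * d')) (c * a' + d * c') (c * (3 * b') + d * d')
        (by linear_combination (det_mul_entries h h')) hcp := by
    rw [g0Of_mul a (3 * b) c d a' (3 * b') c' d' h hc h' hc' (det_mul_entries h h') hcp]
    exact g0Of_congr rfl (by ring) rfl rfl _ _ _ _
  have hcp' : ((3 * M : ℕ) : ℤ) ∣ 3 * c * a' + d * (3 * c') := by
    have := dvd_three_mul' hcp
    have e : 3 * (c * a' + d * c') = 3 * c * a' + d * (3 * c') := by ring
    rwa [e] at this
  rw [hprod, coshift_g0Of φ ε _ _ _ _ _ _ (by linear_combination (det_mul_entries h h')) (dvd_three_mul' hcp),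
    coshift_g0Of φ ε a b c d h hc (by linear_combination h) (dvd_three_mul' hc),
    coshift_g0Of φ ε a' b' c' d' h' hc' (by linear_combination h') (dvd_three_mul' hc'), ← mul_add, ← hadd,
    g0Of_mul a b (3 * c) d a' b' (3 * c') d' _ _ _ _ (det_mul_entries (by linear_combination h)
      (by linear_combination h')) hcp']
  congr 2
  exact g0Of_congr (by ring) (by ring) (by ring) (by ring) _ _ _ _

/-- `restr φ` is additive on `stabInf`, for additive `φ`. [folklore] -/
theorem restr_add (hM3 : ¬ 3 ∣ M) (hadd : IsAddChar φ) :
    ∀ x ∈ stabInf M, ∀ y ∈ stabInf M, restr φ (x * y) = restr φ x + restr φ y := by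
  intro x hx y hy
  obtain ⟨a, b, c, d, h, hc, hc9, rfl⟩ := exists_eq_of_mem_stabInf hM3 hx
  obtain ⟨a', b', c', d', h', hc', hc9', rfl⟩ := exists_eq_of_mem_stabInf hM3 hy
  have hc9'' : ((3 * M : ℕ) : ℤ) ∣ c * a' + d * c' := dvd_add (Dvd.dvd.mul_right hc9 _) (Dvd.dvd.mul_left hc9' _)
  rw [g0Of_mul a b c d a' b' c' d' h hc h' hc' (det_mul_entries h h')
      (dvd_add (Dvd.dvd.mul_right hc _) (Dvd.dvd.mul_left hc' _)),
    restr_g0Of φ _ _ _ _ _ _ hc9'', restr_g0Of φ a b c d h hc hc9, restr_g0Of φ a' b' c' d' h' hc' hc9', ← hadd,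
    g0Of_mul]

/-- **Agreement on `kerAct`**: `coshift φ ε = restr φ` there, from the `ε`-(anti-)invariance of `φ`. [folklore] -/
theorem coshift_eq_restr (hM3 : ¬ 3 ∣ M)
    (hinv : ∀ (a b c d : ℤ) (h : a * d - b * (3 * c) = 1) (hc : ((3 * M : ℕ) : ℤ) ∣ c),
      φ (g0Of a (3 * b) c d (by linear_combination h) hc) = ε * φ (g0Of a b (3 * c) d h (Dvd.dvd.mul_left hc 3))) :
    ∀ x ∈ kerAct M, coshift φ ε x = restr φ x := by
  intro x hx
  obtain ⟨a, b, c, d, h, hc, rfl⟩ := exists_eq_of_mem_stabZero (stabZero_of_kerAct hx)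
  have hc9 : ((3 * M : ℕ) : ℤ) ∣ c := (mem_stabInf_iff hM3).mp (stabInf_of_kerAct hx)
  rw [coshift_g0Of φ ε a b c d h hc (by linear_combination h) (dvd_three_mul' hc),
    restr_g0Of φ a (3 * b) c d h hc hc9, hinv a b c d (by linear_combination h) hc9]

/-- `restr φ` is invariant under conjugation by `stabInf` on `kerAct`. [folklore] -/
theorem restr_conj_of_mem_stabInf (hM3 : ¬ 3 ∣ M) (hadd : IsAddChar φ) {g : Gamma0 M} (hg : g ∈ stabInf M)
    {x : Gamma0 M} (hx : x ∈ kerAct M) : restr φ (g * x * g⁻¹) = restr φ x := by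
  have hxB := stabInf_of_kerAct hx
  rw [restr_add φ hM3 hadd _ ((stabInf M).mul_mem hg hxB) _ ((stabInf M).inv_mem hg),
    restr_add φ hM3 hadd _ hg _ hxB, addOn_map_inv (restr_add φ hM3 hadd) hg]
  abel

/-- `restr φ` is invariant under conjugation by `stabZero` on `kerAct` (via `coshift`). [folklore] -/
theorem restr_conj_of_mem_stabZero (hM3 : ¬ 3 ∣ M) (hadd : IsAddChar φ)
    (hinv : ∀ (a b c d : ℤ) (h : a * d - b * (3 * c) = 1) (hc : ((3 * M : ℕ) : ℤ) ∣ c),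
      φ (g0Of a (3 * b) c d (by linear_combination h) hc) = ε * φ (g0Of a b (3 * c) d h (Dvd.dvd.mul_left hc 3)))
    {g : Gamma0 M} (hg : g ∈ stabZero M) {x : Gamma0 M} (hx : x ∈ kerAct M) :
    restr φ (g * x * g⁻¹) = restr φ x := by
  have hxA := stabZero_of_kerAct hx
  rw [← coshift_eq_restr φ ε hM3 hinv _ (kerAct_conj_mem g hx), ← coshift_eq_restr φ ε hM3 hinv _ hx,
    coshift_add φ ε hadd _ ((stabZero M).mul_mem hg hxA) _ ((stabZero M).inv_mem hg),
    coshift_add φ ε hadd _ hg _ hxA, addOn_map_inv (coshift_add φ ε hadd) hg]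
  abel

end Pair

/-! ### §3. `Γ₀(M) = ⟨T⟩ · stabZero · ⟨T⟩` pointwise, conjugation invariance of `ρ`, and `stabInf = kerAct · ⟨T⟩` -/

section Decompositions

variable {M : ℕ}

/-- The cast of `j.val` back to `ZMod 3` (through `ℤ`). [folklore] -/
theorem intCast_val (j : ZMod 3) : (((j.val : ℕ) : ℤ) : ZMod 3) = j := by
  rw [Int.cast_natCast, ZMod.natCast_zmod_val]

/-- **`Γ₀(M) = T^v · Stab(0) · T^{−u}` pointwise**: every `g` has `u, v` with `T^{−v} g T^{u} ∈ stabZero`. [folklore] -/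
theorem exists_conj_mem_stabZero (g : Gamma0 M) :
    ∃ u v : ZMod 3, Tpow M (-((v.val : ℕ) : ℤ)) * g * Tpow M ((u.val : ℕ) : ℤ) ∈ stabZero M := by
  obtain ⟨u, v, huv⟩ := exists_act_some_eq_some (g : SL(2, ℤ))
  refine ⟨u, v, ?_⟩
  rw [mem_stabZero, Subgroup.coe_mul, Subgroup.coe_mul, act_mul, act_mul, act_Tpow_some, zero_add, intCast_val,
    huv, act_Tpow_some, Int.cast_neg, intCast_val, add_neg_cancel]

variable (φ : Gamma0 (3 * M) → ZMod 3) (ε : ZMod 3)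

/-- **`ρ = restr φ` on `kerAct` is invariant under conjugation by every `g ∈ Γ₀(M)`.** [folklore] -/
theorem restr_conj (hM3 : ¬ 3 ∣ M) (hadd : IsAddChar φ)
    (hinv : ∀ (a b c d : ℤ) (h : a * d - b * (3 * c) = 1) (hc : ((3 * M : ℕ) : ℤ) ∣ c),
      φ (g0Of a (3 * b) c d (by linear_combination h) hc) = ε * φ (g0Of a b (3 * c) d h (Dvd.dvd.mul_left hc 3)))
    (g : Gamma0 M) {x : Gamma0 M} (hx : x ∈ kerAct M) : restr φ (g * x * g⁻¹) = restr φ x := by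
  obtain ⟨u, v, ha⟩ := exists_conj_mem_stabZero g
  set a := Tpow M (-((v.val : ℕ) : ℤ)) * g * Tpow M ((u.val : ℕ) : ℤ) with ha_def
  have hg : g = Tpow M ((v.val : ℕ) : ℤ) * a * Tpow M (-((u.val : ℕ) : ℤ)) := by
    rw [ha_def, ← mul_assoc, ← mul_assoc, Tpow_mul_Tpow, add_neg_cancel, Tpow_zero, one_mul, mul_assoc,
      Tpow_mul_Tpow, add_neg_cancel, Tpow_zero, mul_one]
  -- the three conjugations
  have h1 : restr φ (Tpow M (-((u.val : ℕ) : ℤ)) * x * (Tpow M (-((u.val : ℕ) : ℤ)))⁻¹) = restr φ x :=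
    restr_conj_of_mem_stabInf φ hM3 hadd (Tpow_mem_stabInf _) hx
  set x₁ := Tpow M (-((u.val : ℕ) : ℤ)) * x * (Tpow M (-((u.val : ℕ) : ℤ)))⁻¹ with hx₁
  have hx₁K : x₁ ∈ kerAct M := kerAct_conj_mem _ hx
  have h2 : restr φ (a * x₁ * a⁻¹) = restr φ x₁ := restr_conj_of_mem_stabZero φ ε hM3 hadd hinv ha hx₁K
  have hx₂K : a * x₁ * a⁻¹ ∈ kerAct M := kerAct_conj_mem _ hx₁K
  have h3 : restr φ (Tpow M ((v.val : ℕ) : ℤ) * (a * x₁ * a⁻¹) * (Tpow M ((v.val : ℕ) : ℤ))⁻¹) =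
      restr φ (a * x₁ * a⁻¹) := restr_conj_of_mem_stabInf φ hM3 hadd (Tpow_mem_stabInf _) hx₂K
  have e : g * x * g⁻¹ = Tpow M ((v.val : ℕ) : ℤ) * (a * x₁ * a⁻¹) * (Tpow M ((v.val : ℕ) : ℤ))⁻¹ := by
    rw [hg, hx₁]
    group
  rw [e, h3, h2, h1]

/-- **`stabInf = kerAct · ⟨T⟩`**: every `b ∈ stabInf` is `c · T^k` with `c ∈ kerAct`. [folklore] -/
theorem exists_kerAct_mul_Tpow {b : Gamma0 M} (hb : b ∈ stabInf M) :
    ∃ (k : ℤ) (c : Gamma0 M), c ∈ kerAct M ∧ b = c * Tpow M k := by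
  -- `b·0` is a finite point `j`
  have hne : act (b : SL(2, ℤ)) (some 0) ≠ none := fun h => by
    have := act_injective (b : SL(2, ℤ)) (h.trans (mem_stabInf.mp hb).symm)
    exact Option.some_ne_none _ this
  obtain ⟨j, hj⟩ := Option.ne_none_iff_exists'.mp hne
  refine ⟨((j.val : ℕ) : ℤ), b * Tpow M (-((j.val : ℕ) : ℤ)), ?_, ?_⟩
  · refine kerAct_of_stab ((stabInf M).mul_mem hb (Tpow_mem_stabInf _)) ?_
    have hc : (3 : ℤ) ∣ ((b : SL(2, ℤ)) 1 0 : ℤ) := (act_none_eq_none_iff _).mp hb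
    have ht := act_some_of_dvd (b : SL(2, ℤ)) hc
    rw [ht 0, zero_add] at hj
    rw [mem_stabZero, Subgroup.coe_mul, act_mul, act_Tpow_some, zero_add, Int.cast_neg, intCast_val, ht,
      ← Option.some_injective _ hj, neg_add_cancel]
  · rw [mul_assoc, Tpow_mul_Tpow, neg_add_cancel, Tpow_zero, mul_one]

end Decompositions

end CubeStep

end Summit.BirchSwinnertonDyer.BirchSwinnertonDyer.Theorems.ManinLocalTwoThree
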